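import Literature.MathematicalPhysics.QuantumFieldTheory.Balaban1983to89.B1Eq324BenfattoSect5TupleClusters
import HarnessLib

/-!
# `Balaban1983to89.B1Eq324BenfattoSect5TupleClustersDecay` — [BenfattoEtAl1978] Appendix D p. 166 / §5 p. 159: the Appendix D
# bound for polynomial / tuple-class slots with the decay distributed as a WEIGHT ON EVERY SLOT'S MASS —
# `|𝓔^T_{z̄}(Y₁,…,Y_k)| ≤ C·Π_j 𝓜̃_j^{(δ/2k)·ρ}`, `𝓜̃_j^{c·ρ} = Σ_{T_j} |A^n_Δ|e^{−(ϰ/2)d(Δ)}e^{(δ/2)D²(√d·d(Δ)+d)}·e^{−c·ρ(Δ₀)}` for any `ρ`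
# dominated by the `ℓ¹` distance to the region met by one slot — the EXTENSIVE form the cross-cluster sums of the assembly consume — PROVED

statement-level skeleton of published theorems with citation tags; proofs where landed; nothing here is a claim about the
Yang–Mills mass gap

WHY THIS MODULE (cell `pub-ymgap`, seat `dag-n08-c`, node N08; sequel of `…Sect5TupleClusters` §3).  The uniform bound
`…TupleClusters.abs_ursellOf_tupleSums_condField_le_exp_of_separated` extracts ONE factor `e^{−(δ/2)ρ₀}` and then collapses the
colouring sum into the product of the FULL masses `Π_j 𝓜̃_j`.  For the CROSS terms of the pavement step
(`…Sect5FreeCumulants.cumulantOf_telescope_eq_sum_local_add_cross`: a slot `Ψ″₁(□_m)` against slots anywhere outside `□_m`, including the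
extensive rest `H_{Γ̄₁} + Σ_{m′}Ψ₂(□_{m′})`) a full mass is a VOLUME; what is extensive-finite is the mass WEIGHTED by the decay from `□_m`.
«max ≥ mean»: per tuple colouring the decay to the FARTHEST chosen tuple dominates the average of the decays to all chosen tuples, so the
factor `e^{−(δ/2)·max}` splits as `Π_j e^{−(δ/2k)·ρ(anchor_j)}` and the colouring sum factorises into decay-weighted masses (the
one-tessera lattice sums of `…Sect5CrossCount` / `…Sect5SlotMasses` then bound each of them by `O(A)`, uniformly in the volume).
Print, Appendix D p. 166: *"the exponential factors arising from i) and ii) give rise to an overall dumping factor"*; §5 p. 159: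
*"Collecting all the errors made in this process (4.7) is proven"* — the errors are `|I|·O(1)`.

WHAT IS PROVED (theorems only; no definition, no named fact, no `sorry`; axioms standard).
* ★ `abs_ursellOf_poly_condField_le_prod_decayMass` — generic finite-index form: with a weight `ρ_c ≥ 0` per index such that every
  non-zero colouring has, for EVERY slot `j`, a leg of `f(j₁)` and a leg of `f(j)` at `ℓ¹` distance `≥ ρ_{f(j)}`,
  `|𝓔^T_{z̄}(Z₁,…,Z_k)| ≤ 2^{kD}2^{2^{kD}}K₀^{kD}·Π_j Σ_c |a_{jc}|·e^{(δ/2)θ_c}·e^{−(δ/(2k))ρ_c}` (any `0 ≤ δ ≤ log((2d+α²)/(2d))`; no sign condition on `ρ`).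
* ★★ **`abs_ursellOf_tupleSums_condField_le_prod_decayMass`** — tuple-class slots: if every tuple of the class of slot `j₁` meets `R_A`
  and `ρ : Q₀ → ℝ` satisfies `ρ(y) ≤ ℓ¹(x, y)` for all `x ∈ R_A`, then
  `|𝓔^T_{z̄}(Y₁,…,Y_k)| ≤ 2^{kD}2^{2^{kD}}K₀^{kD}·Π_j Σ_{p,Δ∈T_j p,n} |A^n_Δ|e^{−(ϰ/2)d(Δ)}·e^{(δ/2)D²(√d·d(Δ)+d)}·e^{−(δ/(2k))·ρ(Δ₀)}`
  (`Δ₀` the anchor tessera; under `P̂₀ = condField … ∅` as well).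

HONEST SCOPE / NOT HERE.  The anchored lattice sums of the decay-weighted masses (`…SlotMasses.classSum_le_card_mul` with `R = {y}`,
`…CrossCount.sum_exp_neg_mul_l1_le`), the palette bookkeeping of `…FreeCumulants` and the error collection are the assembly's;
`BasicLemmaPrinted` stays OPEN.  NOT summit progress; count-neutral for N08; nothing of [Balaban1985UV3] is asserted.
-/

open Finset MeasureTheory
open scoped BigOperators

namespace Literature.MathematicalPhysics.QuantumFieldTheory.Balaban1983to89.B1Eq324BenfattoSect5TupleClustersDecay

open _root_.MeasureTheory _root_.ProbabilityTheory
open Literature.Probability.LatticeModels (ursellOf)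
open Literature.MathematicalPhysics.QuantumFieldTheory
open Literature.MathematicalPhysics.QuantumFieldTheory.Balaban1983to89.B1Eq324BenfattoLemma
open Literature.MathematicalPhysics.QuantumFieldTheory.Balaban1983to89.B1Eq324BenfattoConnLength (connLength_nonneg)
open Literature.MathematicalPhysics.QuantumFieldTheory.Balaban1983to89.B1Eq324BenfattoSect5Eq511 (term)
open Literature.MathematicalPhysics.QuantumFieldTheory.Balaban1983to89.B1Eq324BenfattoSect5SlotMoments (legPairs_injective)
open Literature.MathematicalPhysics.QuantumFieldTheory.Balaban1983to89.B1Eq324BenfattoSect5PolyClusters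
  (abs_ursellOf_monomials_condField_le_exp ursellOf_poly_eq_sum_colourings integrable_abs_monomial_pow_condField measurable_monomial)
open Literature.MathematicalPhysics.QuantumFieldTheory.Balaban1983to89.B1Eq324BenfattoAppendixDWick (abs_condCov_le_exp_l1)
open Literature.MathematicalPhysics.QuantumFieldTheory.Balaban1983to89.B1Eq324BenfattoMarkov (isProbabilityMeasure_condField)
open Literature.MathematicalPhysics.QuantumFieldTheory.Balaban1983to89.B1Eq324BenfattoSect5TupleClusters
  (tupleSum_eq_sum_option sum_abs_tcoef_mul_eq card_legs_le_of_mem site_of_mem_legs leg_mem_legs_of_mem l1_site_pseudo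
   sum_sum_l1_legs_le appDConst_mono)

variable {d : ℕ} {α β : ℝ} {s D : ℕ} {ϰ : ℝ} {a : Coef d} {Jr : Finset (B1Eq324BenfattoLemma.Site d)}
variable {σ : Type} [Fintype σ] [DecidableEq σ] [Nonempty σ]

omit [DecidableEq σ] in
/-- «max ≥ mean» for the decay factor: if `M ≥ ρ_j` for all `j` then `e^{−(δ/2)M} ≤ Π_j e^{−(δ/(2k))ρ_j}` (`k = |σ|`, `δ ≥ 0`).
[cite: BenfattoEtAl1978, Appendix D p.166] -/
theorem exp_neg_max_le_prod_exp_neg_mean {δ M : ℝ} (hδ : 0 ≤ δ) (ρ : σ → ℝ) (hM : ∀ j, ρ j ≤ M) :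
    Real.exp (-(δ / 2 * M)) ≤ ∏ j, Real.exp (-(δ / (2 * Fintype.card σ) * ρ j)) := by
  rw [← Real.exp_sum, Real.exp_le_exp, Finset.sum_neg_distrib, ← Finset.mul_sum]
  have hk : (0 : ℝ) < Fintype.card σ := by exact_mod_cast Fintype.card_pos
  have hsum : ∑ j, ρ j ≤ Fintype.card σ * M := by
    calc ∑ j, ρ j ≤ ∑ _j : σ, M := Finset.sum_le_sum fun j _ => hM j
      _ = Fintype.card σ * M := by rw [Finset.sum_const, Finset.card_univ, nsmul_eq_mul]
  have h1 : δ / (2 * Fintype.card σ) * ∑ j, ρ j ≤ δ / (2 * Fintype.card σ) * (Fintype.card σ * M) :=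
    mul_le_mul_of_nonneg_left hsum (by positivity)
  have h2 : δ / (2 * Fintype.card σ) * (Fintype.card σ * M) = δ / 2 * M := by
    field_simp
  linarith

/-- **APPENDIX D WITH THE DECAY DISTRIBUTED OVER THE SLOTS, GENERIC FINITE-INDEX FORM**: slots `Z_j = Σ_c a_{jc}·Π_{l∈J_c} z(x_{cl})`
under `P̄` (`d ≥ 1`, `|u| ≤ K₀` on the legs, `K₀ ≥ max(1,C₀₀)`, `≤ D` legs and intra-cluster `ℓ¹` sum `≤ θ_c` per index, rate
`0 ≤ δ ≤ log((2d+α²)/(2d))`), a weight `ρ_c` per index such that every colouring with non-zero coefficients has, for EVERY slot `j`, a leg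
of `f(j₁)` and a leg of `f(j)` at `ℓ¹` distance `≥ ρ_{f(j)}`:
`|𝓔^T_{z̄}(Z₁,…,Z_k)| ≤ 2^{kD}·2^{2^{kD}}·K₀^{kD}·Π_j Σ_c |a_{jc}|·e^{(δ/2)θ_c}·e^{−(δ/(2k))ρ_c}` — per colouring the designated pair is
taken at the slot with the LARGEST `ρ`, and `e^{−(δ/2)max} ≤ Π_j e^{−(δ/2k)ρ_{f(j)}}`. [cite: BenfattoEtAl1978, Appendix D p.166 and §5 p.159] -/
theorem abs_ursellOf_poly_condField_le_prod_decayMass {ι : Type*} [Fintype ι] [Nonempty ι] {κ : Type}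
    (hα : 0 < α) (hβ : 0 < β) (hd : 0 < d) (Γ : Finset (B1Eq324BenfattoLemma.Site d)) (zbar : B1Eq324BenfattoLemma.Site d → ℝ)
    (ac : σ → ι → ℝ) (Jm : ι → Finset κ) (xs : ι → κ → B1Eq324BenfattoLemma.Site d) {K₀ : ℝ} (hK₀ : 1 ≤ K₀)
    (hK₀' : freeCov d α β 0 0 ≤ K₀) (hu : ∀ c, ∀ l ∈ Jm c, |condMean (freeCov d α β) Γ zbar (xs c l)| ≤ K₀)
    (hq : ∀ c, (Jm c).card ≤ D) (θ : ι → ℝ)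
    (hθ : ∀ c, ∑ l ∈ Jm c, ∑ l' ∈ Jm c, ∑ jj, |((xs c l jj : ℝ) - (xs c l' jj : ℝ))| ≤ θ c)
    {δ : ℝ} (hδ : 0 ≤ δ) (hδle : δ ≤ Real.log ((2 * d + α ^ 2) / (2 * d)))
    (j₁ : σ) (ρ : ι → ℝ)
    (hsep : ∀ f : σ → ι, (∀ j, ac j (f j) ≠ 0) → ∀ j,
      ∃ l₁ ∈ Jm (f j₁), ∃ l₂ ∈ Jm (f j), ρ (f j) ≤ ∑ jj, |((xs (f j₁) l₁ jj : ℝ) - (xs (f j) l₂ jj : ℝ))|) :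
    |ursellOf (fun P : Finset σ => ∫ z, ∏ j ∈ P, (∑ c, ac j c * ∏ l ∈ Jm c, z (xs c l)) ∂condField d α β Γ zbar) Finset.univ| ≤
      2 ^ (Fintype.card σ * D) * 2 ^ 2 ^ (Fintype.card σ * D) * K₀ ^ (Fintype.card σ * D) *
        ∏ j, ∑ c, |ac j c| * Real.exp (δ / 2 * θ c) * Real.exp (-(δ / (2 * Fintype.card σ) * ρ c)) := by
  haveI := isProbabilityMeasure_condField (d := d) hα hβ Γ zbar
  obtain ⟨h0, hsymm, htri, hnn⟩ := l1_site_pseudo (d := d)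
  have hCov : ∀ x y : B1Eq324BenfattoLemma.Site d, |condCov (freeCov d α β) Γ x y| ≤
      K₀ * Real.exp (-(δ * ∑ jj, |((x jj : ℝ) - (y jj : ℝ))|)) := by
    intro x y
    refine (abs_condCov_le_exp_l1 hα hβ hd Γ (fun y : B1Eq324BenfattoLemma.Site d => y) x y).trans ?_
    refine mul_le_mul hK₀' (Real.exp_le_exp.2 ?_) (Real.exp_pos _).le (zero_le_one.trans hK₀)
    have := hnn x y
    nlinarith
  have hm : ∀ (j : σ) (c : ι), AEStronglyMeasurable (fun z : B1Eq324BenfattoLemma.Site d → ℝ => ∏ l ∈ Jm c, z (xs c l))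
      (condField d α β Γ zbar) := fun j c => (measurable_monomial (Jm c) (xs c)).aestronglyMeasurable
  have hint : ∀ (j : σ) (c : ι) (q : ℕ), q ≤ Fintype.card σ →
      Integrable (fun z : B1Eq324BenfattoLemma.Site d → ℝ => |∏ l ∈ Jm c, z (xs c l)| ^ q) (condField d α β Γ zbar) :=
    fun j c q _ => integrable_abs_monomial_pow_condField hα hβ Γ zbar (Jm c) (xs c) q
  rw [ursellOf_poly_eq_sum_colourings (μ := condField d α β Γ zbar) ac
    (fun (_ : σ) (c : ι) (z : B1Eq324BenfattoLemma.Site d → ℝ) => ∏ l ∈ Jm c, z (xs c l)) hm hint]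
  set C := (2 : ℝ) ^ (Fintype.card σ * D) * 2 ^ 2 ^ (Fintype.card σ * D) * K₀ ^ (Fintype.card σ * D) with hC
  have hC0 : 0 ≤ C := by positivity
  have hf : ∀ f : σ → ι,
      |(∏ j, ac j (f j)) * ursellOf (fun P : Finset σ => ∫ z, ∏ j ∈ P, ∏ l ∈ Jm (f j), z (xs (f j) l)
        ∂condField d α β Γ zbar) Finset.univ| ≤
        C * ∏ j, (|ac j (f j)| * Real.exp (δ / 2 * θ (f j)) * Real.exp (-(δ / (2 * Fintype.card σ) * ρ (f j)))) := by
    intro f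
    by_cases hgood : ∀ j, ac j (f j) ≠ 0
    · -- the slot whose chosen index carries the largest weight
      obtain ⟨jm, -, hjm⟩ := Finset.exists_max_image (Finset.univ : Finset σ) (fun j => ρ (f j)) Finset.univ_nonempty
      obtain ⟨l₁, hl₁, l₂, hl₂, hρM⟩ := hsep f hgood jm
      have hAD := abs_ursellOf_monomials_condField_le_exp hα hβ Γ zbar (fun j => Jm (f j)) (fun j => xs (f j))
        (fun x y : B1Eq324BenfattoLemma.Site d => ∑ jj, |((x jj : ℝ) - (y jj : ℝ))|) h0 hsymm htri hnn hK₀ hδ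
        (fun j l hl => hu (f j) l hl) (fun j j' l _ l' _ => hCov (xs (f j) l) (xs (f j') l')) hl₁ hl₂
      have hN : ∑ j, (Jm (f j)).card ≤ Fintype.card σ * D := by
        calc ∑ j, (Jm (f j)).card ≤ ∑ _j : σ, D := Finset.sum_le_sum fun j _ => hq (f j)
          _ = Fintype.card σ * D := by rw [Finset.sum_const, smul_eq_mul, Finset.card_univ]
      have hI : ∑ j, ∑ l ∈ Jm (f j), ∑ l' ∈ Jm (f j), (∑ jj, |((xs (f j) l jj : ℝ) - (xs (f j) l' jj : ℝ))|) ≤ ∑ j, θ (f j) :=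
        Finset.sum_le_sum fun j _ => hθ (f j)
      have hmax := exp_neg_max_le_prod_exp_neg_mean (σ := σ) hδ (fun j => ρ (f j)) fun j => hjm j (Finset.mem_univ j)
      have hexp : Real.exp (-(δ / 2 * ((∑ jj, |((xs (f j₁) l₁ jj : ℝ) - (xs (f jm) l₂ jj : ℝ))|) -
          ∑ j, ∑ l ∈ Jm (f j), ∑ l' ∈ Jm (f j), ∑ jj, |((xs (f j) l jj : ℝ) - (xs (f j) l' jj : ℝ))|))) ≤
          (∏ j, Real.exp (-(δ / (2 * Fintype.card σ) * ρ (f j)))) * ∏ j, Real.exp (δ / 2 * θ (f j)) := by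
        refine le_trans ?_ (mul_le_mul_of_nonneg_right hmax (Finset.prod_nonneg fun j _ => (Real.exp_pos _).le))
        rw [← Real.exp_sum, ← Real.exp_add, Real.exp_le_exp, ← Finset.mul_sum]
        nlinarith
      rw [abs_mul, Finset.abs_prod]
      calc (∏ j, |ac j (f j)|) * |ursellOf (fun P : Finset σ => ∫ z, ∏ j ∈ P, ∏ l ∈ Jm (f j), z (xs (f j) l)
              ∂condField d α β Γ zbar) Finset.univ|
          ≤ (∏ j, |ac j (f j)|) * (C * ((∏ j, Real.exp (-(δ / (2 * Fintype.card σ) * ρ (f j)))) *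
              ∏ j, Real.exp (δ / 2 * θ (f j)))) := by
            refine mul_le_mul_of_nonneg_left (hAD.trans ?_) (Finset.prod_nonneg fun j _ => abs_nonneg _)
            calc (2 : ℝ) ^ (∑ j, (Jm (f j)).card) * 2 ^ 2 ^ (∑ j, (Jm (f j)).card) * (K₀ ^ (∑ j, (Jm (f j)).card) *
                  Real.exp (-(δ / 2 * ((∑ jj, |((xs (f j₁) l₁ jj : ℝ) - (xs (f jm) l₂ jj : ℝ))|) -
                    ∑ j, ∑ l ∈ Jm (f j), ∑ l' ∈ Jm (f j), ∑ jj, |((xs (f j) l jj : ℝ) - (xs (f j) l' jj : ℝ))|))))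
                = (2 : ℝ) ^ (∑ j, (Jm (f j)).card) * 2 ^ 2 ^ (∑ j, (Jm (f j)).card) * K₀ ^ (∑ j, (Jm (f j)).card) *
                  Real.exp (-(δ / 2 * ((∑ jj, |((xs (f j₁) l₁ jj : ℝ) - (xs (f jm) l₂ jj : ℝ))|) -
                    ∑ j, ∑ l ∈ Jm (f j), ∑ l' ∈ Jm (f j), ∑ jj, |((xs (f j) l jj : ℝ) - (xs (f j) l' jj : ℝ))|))) := by
                  ring
              _ ≤ C * ((∏ j, Real.exp (-(δ / (2 * Fintype.card σ) * ρ (f j)))) * ∏ j, Real.exp (δ / 2 * θ (f j))) :=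
                  mul_le_mul (appDConst_mono hK₀ hN) hexp (Real.exp_pos _).le hC0
        _ = C * ∏ j, (|ac j (f j)| * Real.exp (δ / 2 * θ (f j)) * Real.exp (-(δ / (2 * Fintype.card σ) * ρ (f j)))) := by
            rw [Finset.prod_mul_distrib, Finset.prod_mul_distrib]; ring
    · obtain ⟨j, hj⟩ := not_forall.1 hgood
      have hj : ac j (f j) = 0 := not_ne_iff.1 hj
      have hprod : ∏ j, ac j (f j) = 0 := Finset.prod_eq_zero (Finset.mem_univ j) hj
      have hprod' : ∏ j, (|ac j (f j)| * Real.exp (δ / 2 * θ (f j)) * Real.exp (-(δ / (2 * Fintype.card σ) * ρ (f j)))) = 0 :=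
        Finset.prod_eq_zero (Finset.mem_univ j) (by rw [hj, abs_zero, zero_mul, zero_mul])
      rw [hprod, zero_mul, abs_zero, hprod', mul_zero]
  refine (Finset.abs_sum_le_sum_abs _ _).trans ((Finset.sum_le_sum fun f _ => hf f).trans (le_of_eq ?_))
  rw [← Finset.mul_sum, ← Fintype.prod_sum fun j c =>
    |ac j c| * Real.exp (δ / 2 * θ c) * Real.exp (-(δ / (2 * Fintype.card σ) * ρ c))]

/-- **APPENDIX D WITH THE DECAY DISTRIBUTED OVER THE SLOTS, TUPLE-CLASS FORM** (the CROSS supplier in its extensive shape): slots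
`Y_j = Σ_pΣ_{Δ∈T_j p}Σ_n A^n_Δ e^{−(ϰ/2)d(Δ)} Π z_{Δᵢ}^{nᵢ}` under `P̄(dz|z̄_Γ)` (`d ≥ 1`, `|u| ≤ K₀` on the tuples' tesserae,
`K₀ ≥ max(1, C₀₀)`, rate `0 ≤ δ ≤ log((2d+α²)/(2d))`); if every tuple of the class of slot `j₁` meets `R_A` and `ρ : Q₀ → ℝ` satisfies
`ρ(y) ≤ ℓ¹(x, y)` for all `x ∈ R_A` and all `y` (e.g. the `ℓ¹` distance to `R_A`), then with the anchor tessera `Δ₀` of each tuple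
`|𝓔^T_{z̄}(Y₁,…,Y_k)| ≤ 2^{kD}·2^{2^{kD}}·K₀^{kD}·Π_j Σ_{T_j}|A^n_Δ|·e^{−(ϰ/2)d(Δ)}·e^{(δ/2)D²(√d·d(Δ)+d)}·e^{−(δ/(2k))ρ(Δ₀)}`
— every slot's mass is now DECAY-WEIGHTED, hence extensive-finite even for a slot made of all the tuples of a volume.
[cite: BenfattoEtAl1978, Appendix D p.166 and §5 p.159] -/
theorem abs_ursellOf_tupleSums_condField_le_prod_decayMass (hα : 0 < α) (hβ : 0 < β) (hd : 0 < d)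
    (Γ : Finset (B1Eq324BenfattoLemma.Site d)) (zbar : B1Eq324BenfattoLemma.Site d → ℝ)
    (T : σ → (p : ℕ) → Finset (Fin p → Jr)) {K₀ : ℝ} (hK₀ : 1 ≤ K₀) (hK₀' : freeCov d α β 0 0 ≤ K₀)
    (hu : ∀ j, ∀ p ∈ Finset.Icc 1 s, ∀ Δ ∈ T j p, ∀ i,
      |condMean (freeCov d α β) Γ zbar (Δ i : B1Eq324BenfattoLemma.Site d)| ≤ K₀)
    {δ : ℝ} (hδ : 0 ≤ δ) (hδle : δ ≤ Real.log ((2 * d + α ^ 2) / (2 * d)))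
    (j₁ : σ) (RA : Set (B1Eq324BenfattoLemma.Site d))
    (hA : ∀ p ∈ Finset.Icc 1 s, ∀ Δ ∈ T j₁ p, ∃ i, (Δ i : B1Eq324BenfattoLemma.Site d) ∈ RA)
    (ρ : B1Eq324BenfattoLemma.Site d → ℝ) (hρ : ∀ x ∈ RA, ∀ y, ρ y ≤ ∑ j, |((x j : ℝ) - (y j : ℝ))|) :
    |ursellOf (fun P : Finset σ => ∫ z, ∏ j ∈ P,
        (∑ p ∈ Finset.Icc 1 s, ∑ Δ ∈ T j p, ∑ n ∈ admissible p D, term ϰ a z p Δ n) ∂condField d α β Γ zbar) Finset.univ| ≤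
      2 ^ (Fintype.card σ * D) * 2 ^ 2 ^ (Fintype.card σ * D) * K₀ ^ (Fintype.card σ * D) *
        ∏ j, ∑ p ∈ Finset.Icc 1 s, ∑ Δ ∈ T j p, ∑ n ∈ admissible p D,
          |a p (fun i => (Δ i : B1Eq324BenfattoLemma.Site d)) n| *
            Real.exp (-(ϰ / 2) * connLength fun i => (Δ i : B1Eq324BenfattoLemma.Site d)) *
            (Real.exp (δ / 2 * ((D : ℝ) ^ 2 * (Real.sqrt d * connLength (fun i => (Δ i : B1Eq324BenfattoLemma.Site d)) + d))) *
              Real.exp (-(δ / (2 * Fintype.card σ) *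
                ρ (if h : 0 < p then (Δ ⟨0, h⟩ : B1Eq324BenfattoLemma.Site d) else (0 : B1Eq324BenfattoLemma.Site d))))) := by
  classical
  simp_rw [tupleSum_eq_sum_option T]
  have hmem : ∀ c : ↥((Finset.Icc 1 s).sigma fun p =>
      (Finset.univ.filter fun Δ : Fin p → Jr => ∃ j', Δ ∈ T j' p) ×ˢ admissible p D),
      c.1.1 ∈ Finset.Icc 1 s ∧ (∃ j', c.1.2.1 ∈ T j' c.1.1) ∧ c.1.2.2 ∈ admissible c.1.1 D := by
    intro c
    have h := Finset.mem_sigma.1 c.2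
    have h2 := Finset.mem_product.1 h.2
    exact ⟨h.1, (Finset.mem_filter.1 h2.1).2, h2.2⟩
  have hpos : ∀ c : ↥((Finset.Icc 1 s).sigma fun p =>
      (Finset.univ.filter fun Δ : Fin p → Jr => ∃ j', Δ ∈ T j' p) ×ˢ admissible p D), 0 < c.1.1 :=
    fun c => (Finset.mem_Icc.1 (hmem c).1).1
  refine (abs_ursellOf_poly_condField_le_prod_decayMass (D := D) hα hβ hd Γ zbar _ _ _ hK₀ hK₀' ?_ ?_
    (fun c : Option ↥((Finset.Icc 1 s).sigma fun p =>
        (Finset.univ.filter fun Δ : Fin p → Jr => ∃ j', Δ ∈ T j' p) ×ˢ admissible p D) => c.elim 0 fun c =>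
      (D : ℝ) ^ 2 * (Real.sqrt d * connLength (fun i => (c.1.2.1 i : B1Eq324BenfattoLemma.Site d)) + d)) ?_ hδ hδle j₁
    (fun c : Option ↥((Finset.Icc 1 s).sigma fun p =>
        (Finset.univ.filter fun Δ : Fin p → Jr => ∃ j', Δ ∈ T j' p) ×ˢ admissible p D) => c.elim 0 fun c =>
      ρ (c.1.2.1 ⟨0, hpos c⟩ : B1Eq324BenfattoLemma.Site d)) ?_).trans (le_of_eq ?_)
  · rintro (_ | c) l hl
    · simp only [Option.elim_none, Finset.notMem_empty] at hl
    · simp only [Option.elim_some] at hl ⊢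
      obtain ⟨i, hi⟩ := site_of_mem_legs (Jr := Jr) (Δ := c.1.2.1) hl
      obtain ⟨hp, ⟨j', hj'⟩, -⟩ := hmem c
      rw [hi]; exact hu j' _ hp _ hj' i
  · rintro (_ | c)
    · simp only [Option.elim_none, Finset.card_empty]; exact Nat.zero_le _
    · simp only [Option.elim_some]; exact card_legs_le_of_mem (hmem c).2.2
  · rintro (_ | c)
    · simp only [Option.elim_none, Finset.sum_empty]; exact le_rfl
    · simp only [Option.elim_some]
      exact sum_sum_l1_legs_le (D := D) c.1.2.1 (hmem c).2.2
  · intro f hf j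
    have hcls : ∀ j, ∃ c, f j = some c ∧ c.1.2.1 ∈ T j c.1.1 := by
      intro j
      have h := hf j
      rcases hfj : f j with _ | c
      · rw [hfj] at h; exact absurd rfl h
      · rw [hfj] at h
        simp only [Option.elim_some] at h
        by_cases hc : c.1.2.1 ∈ T j c.1.1
        · exact ⟨c, rfl, hc⟩
        · exact absurd (if_neg hc) h
    obtain ⟨c₁, hc₁, hT₁⟩ := hcls j₁
    obtain ⟨c₂, hc₂, -⟩ := hcls j
    obtain ⟨i₁, hi₁⟩ := hA _ (hmem c₁).1 _ hT₁
    refine ⟨((i₁ : ℕ), 0), ?_, (((⟨0, hpos c₂⟩ : Fin c₂.1.1) : ℕ), 0), ?_, ?_⟩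
    · rw [hc₁]; exact leg_mem_legs_of_mem (hmem c₁).2.2 i₁
    · rw [hc₂]; exact leg_mem_legs_of_mem (hmem c₂).2.2 ⟨0, hpos c₂⟩
    · rw [hc₁, hc₂]
      simp only [Option.elim_some, Fin.is_lt, dif_pos, Fin.eta]
      rw [dif_pos (hpos c₂)]
      exact hρ _ hi₁ _
  · congr 1
    refine Finset.prod_congr rfl fun j _ => ?_
    rw [Fintype.sum_option]
    simp only [Option.elim_none, Option.elim_some, abs_zero, zero_mul, zero_add]
    have h := sum_abs_tcoef_mul_eq (s := s) (D := D) (ϰ := ϰ) (a := a) T j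
      (fun c => Real.exp (δ / 2 * ((D : ℝ) ^ 2 * (Real.sqrt d * connLength (fun i => (c.2.1 i : B1Eq324BenfattoLemma.Site d)) + d))) *
        Real.exp (-(δ / (2 * Fintype.card σ) *
          ρ (if h : 0 < c.1 then (c.2.1 ⟨0, h⟩ : B1Eq324BenfattoLemma.Site d) else (0 : B1Eq324BenfattoLemma.Site d)))))
    refine Eq.trans (Finset.sum_congr rfl fun c _ => ?_) h
    rw [dif_pos (hpos c), mul_assoc]

end Literature.MathematicalPhysics.QuantumFieldTheory.Balaban1983to89.B1Eq324BenfattoSect5TupleClustersDecay
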